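import Summits.KontsevichZagierPeriods.Zeta5Search.RVLargeParamVCases
import Summits.KontsevichZagierPeriods.Zeta5Search.RVLargeParamVZLayer
import HarnessLib

/-!
# RVLargeParamVCover — (V⁺) beyond the four proved cases: the cover node (fam-rv gen 9, file 6; request #9.3)

HONEST FRAMING: systematic search; no irrationality claim unless certified.  This file extends gen 9 file 3
(`RVLargeParamVCases.lean`, p250736) by the fourth proved case of the large-parameter constant-term floor (V⁺) — the ZERO-LAYER case
`ClusterValuation.val_ge_of_zLayer` (`RVLargeParamVZLayer.lean`, request #9.2) — and records what is left as two OBSERVED statements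
(`@[conjecture]`, minted by this cell from an exact census, NOT published results, used only as explicit hypotheses):

* `LargeParamVResidualZ` — (V⁺) on the pairs where none of the FOUR decidable tests fires (counting, palindromic, U-layer,
  zero-layer).  NO SUCH PAIR IS KNOWN: the exact census `pub-zeta5-fam-rv/gen9/rv9_zlayer.py` (`out/zlayer_6_19.json`,
  `zlayer_20_22.json`, `zlayer_23_25.json`) finds the four tests covering all 594,471 pairs `(c,p)` with `b₀ ≤ 25`
  (`c ∈ {b, b+e_j}`, window primes `5 ≤ p ≤ m₁(b)`, `p² > b₀+2`, at most one long block; 266,605 pairs with `b₀ ≤ 22`).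
* `LargeParamZCover` — the purely COMBINATORIAL form: for every admissible `(b, j, p)` both `b` and `b + e_j` pass one of the
  four configuration tests (`provedCaseZ`; the tests read only the block configuration `netExp`, never a `p`-adic digit).

PROVED here: `LargeParamZCover → LargeParamVResidualZ → LargeParamVFloor` (hence `→ LargeParamClassLaw → FlatGaugeLawF1`, gen 8's
nodes, by gen 9 files 1 and 3), and (CV⁺) INSTANCE-WISE with the four tests (`largeParamClassLaw_of_provedCaseZ`, no conjecture
node: both Boolean certificates evaluate by `decide`).  So fam-rv's large-parameter class law (CV⁺) is REDUCED to a finite-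
combinatorics covering statement about parameter vectors, verified exactly for `b₀ ≤ 25`.  `p`-adic valuations of rational
numbers only; nothing about irrationality.
-/

noncomputable section

open Finset

namespace Summit.KontsevichZagierPeriods.Zeta5Search.RVFlatGauge

open Summit.KontsevichZagierPeriods.Zeta5Search.CasoratianValuation (casoratian shift InPolytope pairFloors refund)
open Summit.KontsevichZagierPeriods.Zeta5Search.WedgeDictionary (coeffV dOf)
open Summit.KontsevichZagierPeriods.Zeta5Search.ClusterValuation (uLayerCase zLayerCase val_ge_of_uLayer val_ge_of_zLayer)
open Cap

variable {p : ℕ}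

/-- The four proved cases of (V⁺) at target exponent `t`: counting, palindromic (at `t − 1`), U-layer, zero-layer — one
Boolean certificate, evaluable by `decide` on concrete data. -/
def provedCaseZ (c : ℕ → ℤ) (p : ℕ) (t : ℤ) : Bool :=
  countingCase c p t || palCase c p (t - 1) || uLayerCase c p t || zLayerCase c p t

/-- **(V⁺) in the four proved cases.** -/
theorem val_ge_of_provedCaseZ [Fact p.Prime] (c : ℕ → ℤ) (hc : InPolytope c) (hp5 : 5 ≤ p)
    (hwin : (c 0 + 2 : ℤ) < (p : ℤ) ^ 2) {t : ℤ} (h : provedCaseZ c p t = true) (hV : coeffV c ≠ 0) :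
    t ≤ padicValRat p (coeffV c) := by
  simp only [provedCaseZ, Bool.or_eq_true] at h
  rcases h with ((h | h) | h) | h
  · exact val_ge_of_counting c hc hp5 hwin h hV
  · have := val_ge_of_pal c hc hp5 hwin h hV; linarith
  · exact val_ge_of_uLayer c hc hp5 hwin h hV
  · exact val_ge_of_zLayer c hc hp5 hwin h hV

/-- **(V⁺) RESIDUAL BEYOND THE FOUR CASES, OBSERVED** (minted by this cell; NOT a published result): the large-parameter
constant-term floor on the pairs where none of the four decidable tests fires.  No such pair is known (`b₀ ≤ 25`: 0 of 594,471). -/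
@[conjecture] def LargeParamVResidualZ : Prop :=
  ∀ (b : ℕ → ℤ) (j p i : ℕ), InPolytope b → 1 ≤ j → j ≤ 7 → InPolytope (shift b j) → p.Prime → 5 ≤ p →
    (b 0 + 2 : ℤ) < (p : ℤ) ^ 2 → (∀ k ∈ (range 7).erase i, b 0 - 2 * b (k + 1) < p) →
    (provedCaseZ b p (-pairFloors b p + lpBonus b p) = false →
      coeffV b ≠ 0 → -pairFloors b p + lpBonus b p ≤ padicValRat p (coeffV b)) ∧
    (provedCaseZ (shift b j) p (-pairFloors b p + lpBonus b p) = false →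
      coeffV (shift b j) ≠ 0 → -pairFloors b p + lpBonus b p ≤ padicValRat p (coeffV (shift b j)))

/-- **COMBINATORIAL COVER, OBSERVED** (minted by this cell; NOT a published result): in the large-parameter regime both constant
terms pass one of the four configuration tests (exact census: all 594,471 pairs with `b₀ ≤ 25`). -/
@[conjecture] def LargeParamZCover : Prop :=
  ∀ (b : ℕ → ℤ) (j p i : ℕ), InPolytope b → 1 ≤ j → j ≤ 7 → InPolytope (shift b j) → p.Prime → 5 ≤ p →
    (b 0 + 2 : ℤ) < (p : ℤ) ^ 2 → (∀ k ∈ (range 7).erase i, b 0 - 2 * b (k + 1) < p) →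
    provedCaseZ b p (-pairFloors b p + lpBonus b p) = true ∧
      provedCaseZ (shift b j) p (-pairFloors b p + lpBonus b p) = true

/-- **cover ⇒ residual** (the residual set is empty under the cover). -/
theorem largeParamVResidualZ_of_zCover (hC : LargeParamZCover) : LargeParamVResidualZ := by
  intro b j p i hb hj1 hj7 hb' hpr hp5 hwin hshort
  obtain ⟨h1, h2⟩ := hC b j p i hb hj1 hj7 hb' hpr hp5 hwin hshort
  refine ⟨fun hf => ?_, fun hf => ?_⟩
  · rw [h1] at hf; cases hf
  · rw [h2] at hf; cases hf

/-- **REDUCTION (PROVED): residual ⇒ (V⁺).**  Outside the residual set (V⁺) is a theorem (one of the four proved cases). -/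
theorem largeParamVFloor_of_residualZ (hR : LargeParamVResidualZ) : LargeParamVFloor := by
  intro b j p i hb hj1 hj7 hb' hpr hp5 hwin hshort
  haveI : Fact p.Prime := ⟨hpr⟩
  have hwin' : (shift b j 0 + 2 : ℤ) < (p : ℤ) ^ 2 := by rwa [BigPrime.shift_zero b hj1]
  obtain ⟨h1, h2⟩ := hR b j p i hb hj1 hj7 hb' hpr hp5 hwin hshort
  refine ⟨fun hV => ?_, fun hV => ?_⟩
  · cases hc : provedCaseZ b p (-pairFloors b p + lpBonus b p)
    · exact h1 hc hV
    · exact val_ge_of_provedCaseZ b hb hp5 hwin hc hV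
  · cases hc : provedCaseZ (shift b j) p (-pairFloors b p + lpBonus b p)
    · exact h2 hc hV
    · exact val_ge_of_provedCaseZ (shift b j) hb' hp5 hwin' hc hV

/-- **residual ⇒ (CV⁺)**, **residual ⇒ FLAT on (F1)**, and the same from the combinatorial cover. -/
theorem largeParamClassLaw_of_residualZ (hR : LargeParamVResidualZ) : LargeParamClassLaw :=
  largeParamClassLaw_of_vFloor (largeParamVFloor_of_residualZ hR)

/-- residual ⇒ FLAT on (F1). -/
theorem flatGaugeLawF1_of_residualZ (hR : LargeParamVResidualZ) : FlatGaugeLawF1 :=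
  flatGaugeLawF1_of_vFloor (largeParamVFloor_of_residualZ hR)

/-- cover ⇒ (V⁺). -/
theorem largeParamVFloor_of_zCover (hC : LargeParamZCover) : LargeParamVFloor :=
  largeParamVFloor_of_residualZ (largeParamVResidualZ_of_zCover hC)

/-- cover ⇒ (CV⁺). -/
theorem largeParamClassLaw_of_zCover (hC : LargeParamZCover) : LargeParamClassLaw :=
  largeParamClassLaw_of_residualZ (largeParamVResidualZ_of_zCover hC)

/-- cover ⇒ FLAT on (F1). -/
theorem flatGaugeLawF1_of_zCover (hC : LargeParamZCover) : FlatGaugeLawF1 :=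
  flatGaugeLawF1_of_residualZ (largeParamVResidualZ_of_zCover hC)

/-- The gen-9 file-3 residual follows from the new one (the zero-layer case absorbs part of it). -/
theorem largeParamVResidual_of_residualZ (hR : LargeParamVResidualZ) : LargeParamVResidual := by
  intro b j p i hb hj1 hj7 hb' hpr hp5 hwin hshort
  haveI : Fact p.Prime := ⟨hpr⟩
  have hwin' : (shift b j 0 + 2 : ℤ) < (p : ℤ) ^ 2 := by rwa [BigPrime.shift_zero b hj1]
  obtain ⟨h1, h2⟩ := hR b j p i hb hj1 hj7 hb' hpr hp5 hwin hshort
  refine ⟨fun hc hpal hu hV => ?_, fun hc hpal hu hV => ?_⟩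
  · cases hz : zLayerCase b p (-pairFloors b p + lpBonus b p)
    · exact h1 (by simp [provedCaseZ, hc, hpal, hu, hz]) hV
    · exact val_ge_of_zLayer b hb hp5 hwin hz hV
  · cases hz : zLayerCase (shift b j) p (-pairFloors b p + lpBonus b p)
    · exact h2 (by simp [provedCaseZ, hc, hpal, hu, hz]) hV
    · exact val_ge_of_zLayer (shift b j) hb' hp5 hwin' hz hV

/-- **(CV⁺) INSTANCE-WISE, PROVED (no conjecture node):** the large-parameter class law at every `(b, j, p)` at which both
constant terms pass one of the four tests (two Boolean certificates, evaluable by `decide`). -/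
theorem largeParamClassLaw_of_provedCaseZ (b : ℕ → ℤ) {j p i : ℕ} (hb : InPolytope b) (hj1 : 1 ≤ j) (hj7 : j ≤ 7)
    (hb' : InPolytope (shift b j)) (hpr : p.Prime) (hp5 : 5 ≤ p) (hwin : (b 0 + 2 : ℤ) < (p : ℤ) ^ 2)
    (hshort : ∀ k ∈ (range 7).erase i, b 0 - 2 * b (k + 1) < p)
    (h1 : provedCaseZ b p (-pairFloors b p + lpBonus b p) = true)
    (h2 : provedCaseZ (shift b j) p (-pairFloors b p + lpBonus b p) = true) (hcas : casoratian b j ≠ 0) :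
    refund b p - pairFloors b p + lpBonus b p ≤ padicValRat p (casoratian b j) := by
  haveI : Fact p.Prime := ⟨hpr⟩
  have hwin' : (shift b j 0 + 2 : ℤ) < (p : ℤ) ^ 2 := by rwa [BigPrime.shift_zero b hj1]
  exact ClusterValuation.casoratianLaw_of_vBonus b hb hj1 hj7 hb' hp5 hwin
    (fun x _ => ClusterValuation.classPoleCount_le_one_of_short_blocks b hb hpr.pos hshort x) (lpBonus b p)
    (fun hV => val_ge_of_provedCaseZ b hb hp5 hwin h1 hV)
    (fun hV => val_ge_of_provedCaseZ (shift b j) hb' hp5 hwin' h2 hV) hcas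

/-- Kernel instances: the pair `b = (12;5,5,4,4,4,4,0)`, `b + e_7 = (12;5,5,4,4,4,4,1)` at `p = 5` (`N_5 = 6`, bonus `2`,
`t = −4`) — `b` is a U-layer configuration and `b + e_7`, residual for the first three tests, is a zero-layer configuration:
both certificates of `largeParamClassLaw_of_provedCaseZ` hold. -/
example :
    let b : ℕ → ℤ := fun k => (([12, 5, 5, 4, 4, 4, 4, 0] : List ℤ)).getD k 0
    let c : ℕ → ℤ := fun k => (([12, 5, 5, 4, 4, 4, 4, 1] : List ℤ)).getD k 0
    pairFloors b 5 = 6 ∧ lpBonus b 5 = 2 ∧ provedCaseZ b 5 (-4) = true ∧ countingCase c 5 (-4) = false ∧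
      palCase c 5 (-5) = false ∧ uLayerCase c 5 (-4) = false ∧ provedCaseZ c 5 (-4) = true := by
  decide

/-- The other two formerly residual archetypes: `(14;7,4,4,4,4,4,1)` at `p = 7` and `(16;6,6,6,6,6,6,1)` at `p = 5`. -/
example :
    let c : ℕ → ℤ := fun k => (([14, 7, 4, 4, 4, 4, 4, 1] : List ℤ)).getD k 0
    countingCase c 7 (-4) = false ∧ palCase c 7 (-5) = false ∧ uLayerCase c 7 (-4) = false ∧
      provedCaseZ c 7 (-4) = true := by
  decide

example :
    let c : ℕ → ℤ := fun k => (([16, 6, 6, 6, 6, 6, 6, 1] : List ℤ)).getD k 0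
    countingCase c 5 (-4) = false ∧ palCase c 5 (-5) = false ∧ uLayerCase c 5 (-4) = false ∧
      provedCaseZ c 5 (-4) = true := by
  decide

end Summit.KontsevichZagierPeriods.Zeta5Search.RVFlatGauge
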